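import Mathlib
import HarnessLib
import Summits.PneNP.PneNP.Theses.KrwChromaticSteering
import Summits.PneNP.PneNP.Theorems.KrwChromaticSteeringCompositionIteration
import Summits.PneNP.PneNP.Theorems.KrwChromaticSteeringCompositionIterationFrac
import Summits.PneNP.PneNP.Theorems.StrongComposition.Negative.NoFiniteRefutation
import Literature.Computability.Complexity.KWDepthHardFunctions

/-!
# Crux `StrongComposition` (stmt-PneNP-18538) — § Vector gadgets: the crux's door family embedded into the
XOR-composition programme (Mihajlin–Smal 2021; Mihajlin–Sofronova 2022; Wu 2024)

Planner workfile (cell `pnp-ideate`, seat p5, generation 8, lens «embed»).  Kernel-checked, `sorry`-free; imports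
only LANDED Theorems files (the B-frac bookkeeping `not_NC1_of_hardFunctions`, the Negative lemma
`exists_solves_sendInput`).  Route `KrwChromaticSteering`: `closes (h1 : StrongComposition) (h2 : StandardFromStrong)
(s3 : CompositionIteration — proved) (hR : FormulaLayerLift — residual (R)) : PneNP`.

**What this file is NOT.** It does not prove the crux, any door, or `P ≠ NP`; every `theorem … : PneNP` /
`… ∉ NC1` below carries an OPEN conjecture (`@[conjecture]` def) as a hypothesis.  FRONTIER-grade material: the
doors imply a major separation (`P ⊄ NC¹`); nothing here is claimed to lower the crux.

**What it IS.**  HOST = the XOR-composition programme.  Mihajlin–Smal (CCC 2021) replace block composition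
`f ⋄ g` (inner `g : {0,1}^n → {0,1}`, ONE output bit per row) by `f ⊞ₘ g`, whose inner GADGET
`g : {0,1}^k → {0,1}^k` is vector-valued and XORed over `m` copies, conjecture `D(f ⊞ₘ g) ≥ D(f) + εk` for SOME `g`
(Conj. 11) and prove that this implies `P ⊄ NC¹` (Thm. 12); Mihajlin–Sofronova (CCC 2022, Thm 1.3/1.4) and Wu
(arXiv:2404.15613, Thm 1.6/1.7) PROVE `∃g`-composition lower bounds of exactly this type for most `f` against
formulas whose top layers are AND gates (`k = n`, one block).  DICTIONARY (object ↦ object, all typed below):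
inner function `g` ↦ gadget `H : {0,1}^{r·b} → {0,1}^b` of RATE `r` and WIDTH `b` (`xorGadget m g`: `r = m`, `b = k`;
block composition: `b = 1`, `r = n`); `f ⋄ g` ↦ `vecComp f H = f ∘ H^q` on a `q × rb` matrix; the route's doors
`WeakKRWFrac` / `GainWeakKRW G` (width `1`, all rates; `LayeredKRW.lean` § Scale) ↦ `VecGainKRW r G` (rate `r` fixed,
all widths) ⊇ `XorGainKRW m G` (XOR gadgets) ⊇ `XorKRWConjecture` (MS21 Conj. 11 verbatim: lossless, gain `⌊k/K⌋`);
the tower `h_{j+1} = h_j ⋄ g_j` on `k^j` bits ↦ `h_{j+1} = h_j ∘ H_j^{r^j}` on an `r^{j+1} × b` matrix (MS21's `h_t`).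
So the crux's door family is a TWO-PARAMETER family (rate, width): C1 ∧ C2 live on the line `width = 1`, the XOR
programme on the lines `rate = m`; this file proves what each fixed-rate line needs and where it is false.

## Theorems (kernel-checked in this file)

* (T) THRESHOLD ON EVERY FIXED-RATE LINE. `notNC1_of_vecGainKRW : 1 ≤ r → SqrtGain r G → VecGainKRW r G →
  ∃ L ∈ P, L ∉ NC¹`, `SqrtGain r G := (∀ b, G b ≤ r b) ∧ ∀ A, ∃ b₀, ∀ b ≥ b₀, A·b ≤ G(b)²`: ANY gain with
  `G(b)²/b → ∞` (`b^{0.51}`, `√b · log b`, `b/K`) under the route's loss `c(⌊log₂ arity⌋ + 1)` separates `P` from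
  `NC¹` — no `log b` in the threshold (contrast `√(n log n)` on the width-1 line) because at a fixed rate the outer
  arity costs `⌊log₂ r⌋ + 1` per level: `iterate_levels_vec` (tower with uniform per-level loss `B < g`),
  `exists_hard_function_of_vecGain` (`E ≈ G(b)/4c(⌊log₂ r⌋+1)` levels, depth `≈ E·G(b)/2 > c₀ (rb + E log r + log b)`
  as soon as `G(b)² ≥ A b`, circuits `≤ E · r^E b · univBound(rb)` via `CktSize.pi_const` + `cktSize_univ_fin (r b)`),
  `pneNP_of_vecGainKRW (…) (hR : FormulaLayerLift) : PneNP`.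
* (MS) `notNC1_of_xorKRWConjecture : XorKRWConjecture → ∃ L ∈ P, L ∉ NC¹` = Mihajlin–Smal's THEOREM 12, kernel-checked
  (`xorGainKRW_of_xorKRWConjecture`, `sqrtGain_div`, `notNC1_of_xorGainKRW`), and SHARPENED twice: (i) with the
  route's log-loss any gain `G(k)²/k → ∞` suffices in place of `εk`; (ii) in the conjecture's own LOSSLESS form ANY
  UNBOUNDED gain `γ(k) → ∞` suffices — `VecKRWLossless`, `exists_hard_function_of_lossless` (without a loss term the
  number of levels is free: `d = c₀(rb + log b) + 1` levels at one width with `G(b) > c₀ log r`),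
  `notNC1_of_vecKRWLossless`, `notNC1_of_xorKRW_unboundedGain`, second proof `notNC1_of_xorKRWConjecture'`.
* (W) A PRINTED OPEN PROBLEM BELOW THE CRUXES. `WuConjecture` = Wu 2024 Conj. 1.2 typed (for some `ε = 1/K` and
  infinitely many `n`, NON-CONSTANT `f, g` on `n` bits with `D(f ⋄ g) ≥ (1+ε)n`; "we don't even know how to prove
  this weaker conjecture … the closest answer is Meir's strong composition theorem, but we don't know how to prove
  it for standard composition" [corpus: paper:arxiv-2404.15613 p.3] — verbatim the route's C2 gap);
  `wuConjecture_of_weakKRWFrac : WeakKRWFrac → WuConjecture` (door at the diagonal `m = n = 2^t` on a depth-hard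
  outer function, `DepthHardFunctionsExist_holds` = Riordan–Shannon via KW, landed in Literature) and
  `wuConjecture_of_cruxes : StrongComposition → StandardFromStrong → WuConjecture` — the route's non-residual
  conjunction cannot close before Wu's Conjecture 1.2 is settled (BC9 ceiling in print for it: restricted-top
  XOR composition, MS22 Thm 1.4 / Wu24 Thm 1.7, and Meir's STRONG composition = C1's origin).
* (E) THE EDGE `rate = 1` IS FALSE. `not_vecGainKRW_one : (∀ c, ∃ b ≥ 1, c(⌊log₂ b⌋+1) < G b) → ¬ VecGainKRW 1 G`,
  `not_xorGainKRW_one`, `not_xorGainKRW_one_div : 0 < K → ¬ XorGainKRW 1 (· / K)`: at rate 1 the composed function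
  has the same width, so a non-constant outer function of MAXIMAL optimal KW depth on a `1 × b` matrix (`optDepth`,
  `Finset.exists_max_image`; protocols exist by `Negative.NoFiniteRefutation.exists_solves_sendInput`) cannot gain
  anything; `m ≥ 2` XOR copies are NECESSARY — matching MS21's "entanglement" motivation [MS21 p.5] — and `1 ≤ m` is
  typed into `XorKRWConjecture` because over the empty input index of `m = 0` the protocol type is empty (vacuity).

## Placement / calibration (presearch 2026-08-28, corpus fts + vec AND galaxy; labelled)

* Host statements: MS21 Def. 10 / Conj. 11 / Thm. 12 / Def. 13 / Conj. 14–15 / Thm. 17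
  [corpus: paper:url-46bb5245c101 p.4–6] (`doi:10.4230/LIPIcs.CCC.2021.38`, acq-13932 moot: OA copy held).  MS21's own
  theorems have a UNIVERSAL relation on top (`U_n ⊞ KW_g`, Thm 21; `U_n ⊞ MUX`, Thm 23) [ibid. p.6–8]: no arrow to a
  function-outer door (`CC(KW_f ∘ ·) ≤ CC(U ∘ ·)` points the wrong way).
* Rungs in print with a FUNCTION on top and `∃g`: Mihajlin–Sofronova CCC 2022 Thm 1.3/1.4, Wu 2024 Thm 1.6/1.7
  [corpus: paper:arxiv-2404.15613 p.3–5]: for MOST `f` on `n` bits some `g : {0,1}^n → {0,1}^n` makes `f(g(x) ⊕ y)`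
  (rate 2, width `n`, ONE block `q = 1`) hard for formulas with AND-only top layers (`(4 − o(1)) log` for a modified
  Andreev function).  In the dictionary: the `q = 1`, `r = 2` slice of `VecGainKRW`, RESTRICTED protocols (Bob alone in
  the top layers), most `f` instead of all; the unrestricted `q = 1` statement for some pair is Wu's Conj. 1.2 [ibid. p.3];
  for all `q` it is the door.  BC9: method family = "double measurement" / well-mixed sets / sub-additive two-argument
  formula measures [ibid. p.5]; printed ceiling = the top restriction and `q = 1` (capped); lift = unrestricted protocols
  at all `q` — and (T) says the lift need only deliver gain `≫ √k` with log-loss, (MS-ii) any `ω(1)` if lossless.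
* Explicit gadgets are absorbed exactly as on the width-1 line: the multiplexer FUNCTION `M_n` gives
  `+n − O(log* n)` against `log₂ L(f)` only at inner arity `2^n + n` (MS21 Thm 9 [p.4]), and parity-OUTER ⊛ random-inner
  (Chukhin–Kulikov–Mihajlin 2024 Cor. 2 [corpus: paper:arxiv-2410.10189 p.3], easy-outer) gains `≤ log m` — in both
  cases gain `O(log arity) ≤` the loss term.
* Queries run: `lit search --hybrid "XOR composition KRW conjecture formula depth lower bound"` →
  [corpus: paper:arxiv-2410.10189 p.1,3], [corpus: paper:arxiv-2404.15613 p.13]; `lit vsearch "a composition theorem with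
  only sublinear inner gain already separates P from NC1"` → nothing relevant; `lit galaxy search "XOR-KRW|multiplexor
  relation" --star all` → no hits.  No source states a sub-linear — let alone `ω(1)` — sufficient gain for Theorem 12:
  (T) and (MS-ii) appear new AS STATEMENTS; the tower itself is MS21's (and KRW 1995's).

## Why easier / what the host exposes (honest)

Rate `m ≥ 2` with width `b ≥ 2` is the first place where iteration does NOT close up inside one width (E) and where
each gadget output bit depends on all `m·k` bits of its block-row (MS21's information-leak heuristic), and it is the
only corner of the composition landscape with PROVED `∃g` composition bounds under a function (MS22/Wu24).  Nothing
here lowers the crux: `VecGainKRW` / `XorGainKRW` are SIBLINGS of C1's door in the (rate, width) family, not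
consequences or strengthenings of it (no arrow either way is claimed).  Cheapest falsifier of the XOR line: a width
`k`, `m = 2`, `q = 1`, and `f` of maximal optimal depth on `k` bits such that for EVERY `g : {0,1}^k → {0,1}^k` some
protocol for `KW_{f ⊞₂ g}` has depth `< D(f) + √k`; finite, but already `k = 4` has `2^{64}` gadgets (symmetry classes
needed); the `m = 1` edge is settled in-Lean (E).

Names used: `KrwChromaticSteeringCompositionIterationFrac.not_NC1_of_hardFunctions` (landed p615650),
`KrwCompositionIteration.{solves_comap_of_embedding, solves_of_forall_eq, exists_mul_succ_lt_two_pow, univBound}`,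
`CktSize.{proj, pi_const, rewire, comp, congr, of_le, toCircuit}`, `cktSize_univ_fin`, `Hirahara2020.univBound_le_two_pow`,
`KWTree.{comap, depth_comap, depth_leaf, Solves}`, `StrongComposition.Negative.NoFiniteRefutation.exists_solves_sendInput`,
`Literature.Computability.Complexity.DepthHardFunctionsExist_holds` (landed), `KrwChromaticSteeringCompositionIterationFrac.{weakKRWFrac_of,
strongCompositionFrac_of_strongComposition}`, `Fintype.equivOfCardEq` (re-blocking `r^j × rb ≃ r^{j+1} × b` by ANY bijection — the doors quantify over all `f`, so
the bijection is immaterial), `finProdFinEquiv`, `Finset.exists_max_image`, `Nat.sInf_mem`.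
-/

set_option autoImplicit false
set_option linter.dupNamespace false

namespace Summit.PneNP.PneNP.Cruxes.StrongComposition.VectorGadgetKRW

open Literature.Computability.Complexity
open Summit.PneNP.PneNP.Theorems.KrwCompositionIteration
open Summit.PneNP.PneNP.Theorems.KrwChromaticSteeringCompositionIterationFrac

universe u v

/-! ### Definitions -/

/-- **Vector-gadget composition** `f ∘ H^q`: the input is a `q × a` Boolean matrix; the gadget
`H : {0,1}^a → {0,1}^b` is applied to every row and `f : {0,1}^{q × b} → {0,1}` to the resulting
`q × b` matrix.  Block composition `f ⋄ g` is the case `b = 1`; Mihajlin–Smal's XOR-composition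
`f ⊞ₘ g` is the case `H = xorGadget m g` (`a = m·k`, `b = k`). -/
def vecComp {q a b : ℕ} (f : (Fin q × Fin b → Bool) → Bool) (H : (Fin a → Bool) → (Fin b → Bool)) :
    (Fin q × Fin a → Bool) → Bool :=
  fun x => f (fun p => H (fun l => x (p.1, l)) p.2)

/-- The `j`-th of `m` consecutive `k`-bit blocks of `y ∈ {0,1}^{m·k}` (row-major, `finProdFinEquiv`). -/
def copy {m k : ℕ} (y : Fin (m * k) → Bool) (j : Fin m) : Fin k → Bool :=
  fun l => y (finProdFinEquiv (j, l))

/-- **The XOR gadget** of Mihajlin–Smal: `(y₁, …, yₘ) ↦ g(y₁) ⊕ ⋯ ⊕ g(yₘ)` (bitwise), for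
`g : {0,1}^k → {0,1}^k`; output bit `i` is the parity of `#{j : g(y_j)_i = 1}`.
[cite: MihajlinSmal2021, Def. 10] -/
def xorGadget {k : ℕ} (m : ℕ) (g : (Fin k → Bool) → (Fin k → Bool)) :
    (Fin (m * k) → Bool) → (Fin k → Bool) :=
  fun y i => decide (Odd ((Finset.univ.filter fun j : Fin m => g (copy y j) i = true).card))

/-- **The XOR-KRW conjecture, verbatim** (Mihajlin–Smal 2021, Conj. 11): there are `m ∈ ℕ` and `ε > 0`
(here `ε = 1/K`) such that for all `n, k` with `k ∣ n` (here `n = q·k`) and every non-constant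
`f : {0,1}^n → {0,1}` some `g : {0,1}^k → {0,1}^k` has `D(f ⊞ₘ g) ≥ D(f) + εk` — in the tree's
extraction form: every protocol for `KW_{f ⊞ₘ g}` yields one for `KW_f` shorter by `⌊k/K⌋`.  LOSSLESS, as
printed.  `1 ≤ m` is explicit here: over the EMPTY input index of `m = 0` the tree's protocol type is empty and
the clause would hold vacuously (in formula semantics the `m = 0` instance is false; `m = 1` is refuted below,
`not_xorGainKRW_one_div`, so the conjecture needs `m ≥ 2`).  OPEN. [cite: MihajlinSmal2021, Conj. 11] -/
@[conjecture] def XorKRWConjecture : Prop :=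
  ∃ m K : ℕ, 1 ≤ m ∧ 0 < K ∧ ∀ q k : ℕ, ∀ f : (Fin q × Fin k → Bool) → Bool, (∃ x y, f x ≠ f y) →
    ∃ g : (Fin k → Bool) → (Fin k → Bool), ∀ P : KWTree (Fin q × Fin (m * k)),
      P.Solves (vecComp f (xorGadget m g)) →
        ∃ Q : KWTree (Fin q × Fin k), Q.Solves f ∧ Q.depth + k / K ≤ P.depth

/-- **XOR door with gain `G`** and the route's logarithmic loss: for every non-constant `f` on `q·k` bits
some `g : {0,1}^k → {0,1}^k` makes every protocol for `KW_{f ⊞ₘ g}` yield a `KW_f`-protocol shorter by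
`G(k) − c(⌊log₂(q·m·k)⌋ + 1)`.  OPEN for every super-logarithmic `G`. -/
@[conjecture] def XorGainKRW (m : ℕ) (G : ℕ → ℕ) : Prop :=
  ∃ c : ℕ, ∀ q k : ℕ, 1 ≤ k → ∀ f : (Fin q × Fin k → Bool) → Bool, (∃ x y, f x ≠ f y) →
    ∃ g : (Fin k → Bool) → (Fin k → Bool), ∀ P : KWTree (Fin q × Fin (m * k)),
      P.Solves (vecComp f (xorGadget m g)) →
        ∃ Q : KWTree (Fin q × Fin k), Q.Solves f ∧ Q.depth + G k ≤ P.depth + c * (Nat.log 2 (q * (m * k)) + 1)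

/-- **Vector-gadget door of rate `r` with gain `G`**: for every non-constant `f` on a `q × b` matrix some
gadget `H : {0,1}^{r·b} → {0,1}^b` makes every protocol for `KW_{f ∘ H^q}` yield a `KW_f`-protocol shorter
by `G(b) − c(⌊log₂(q·r·b)⌋ + 1)`.  `XorGainKRW m G` is the sub-case `H = xorGadget m g`; the block door
`GainWeakKRW` of `LayeredKRW.lean` § Scale is the `r`-VARYING width-1 diagonal of this family (`b = 1`, `r` = inner
arity, gain `G(r)`); at FIXED `r` the edge `b = 1` carries only the constant gain `G(1)`.  OPEN. -/
@[conjecture] def VecGainKRW (r : ℕ) (G : ℕ → ℕ) : Prop :=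
  ∃ c : ℕ, ∀ q b : ℕ, 1 ≤ b → ∀ f : (Fin q × Fin b → Bool) → Bool, (∃ x y, f x ≠ f y) →
    ∃ H : (Fin (r * b) → Bool) → (Fin b → Bool), ∀ P : KWTree (Fin q × Fin (r * b)),
      P.Solves (vecComp f H) →
        ∃ Q : KWTree (Fin q × Fin b), Q.Solves f ∧ Q.depth + G b ≤ P.depth + c * (Nat.log 2 (q * (r * b)) + 1)

/-- **Threshold hypothesis** for a fixed rate `r`: `G(b) ≤ r·b`, and `G(b)² ≥ A·b` eventually for every `A`
(i.e. `G(b)²/b → ∞`; e.g. `G(b) = ⌈b^{1/2+ε}⌉`, `⌈√b · log b⌉`, `b / K`). -/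
def SqrtGain (r : ℕ) (G : ℕ → ℕ) : Prop :=
  (∀ b, G b ≤ r * b) ∧ ∀ A : ℕ, ∃ b₀ : ℕ, ∀ b, b₀ ≤ b → A * b ≤ G b * G b

theorem vecGainKRW_of_xorGainKRW {m : ℕ} {G : ℕ → ℕ} (h : XorGainKRW m G) : VecGainKRW m G := by
  obtain ⟨c, hc⟩ := h
  refine ⟨c, fun q k hk f hf => ?_⟩
  obtain ⟨g, hg⟩ := hc q k hk f hf
  exact ⟨xorGadget m g, hg⟩

/-! ### Transport of protocols and circuits along a re-indexing of the coordinates -/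

/-- A protocol for `x' ↦ V (x' ∘ e)` (coordinates renamed by an equivalence `e`) gives one for `V`, of the
same depth. -/
theorem exists_solves_of_reindex {ι : Type u} {κ : Type v} (e : ι ≃ κ) (V : (ι → Bool) → Bool)
    (Q : KWTree κ) (hQ : Q.Solves fun z => V (fun i => z (e i))) :
    ∃ P : KWTree ι, P.Solves V ∧ P.depth = Q.depth := by
  refine ⟨Q.comap (fun x k => x (e.symm k)) (fun x k => x (e.symm k)) e.symm, ?_,
    KWTree.depth_comap _ _ _ Q⟩
  refine solves_comap_of_embedding hQ _ _ (fun x => ?_) (fun x y k hk => hk)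
  simp only [Equiv.symm_apply_apply]

/-- Conversely, a protocol for `V` gives one for `x' ↦ V (x' ∘ e)`, of the same depth. -/
theorem exists_solves_reindex {ι : Type u} {κ : Type v} (e : ι ≃ κ) (V : (ι → Bool) → Bool)
    (P : KWTree ι) (hP : P.Solves V) :
    ∃ Q : KWTree κ, (Q.Solves fun z => V (fun i => z (e i))) ∧ Q.depth = P.depth := by
  refine ⟨P.comap (fun z i => z (e i)) (fun z i => z (e i)) e, ?_, KWTree.depth_comap _ _ _ P⟩
  exact solves_comap_of_embedding hP _ _ (fun x => rfl) (fun x y i hi => by simpa using hi)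

/-! ### The tower with vector gadgets -/

/-- **The XOR/vector-gadget tower, level by level** (Mihajlin–Smal 2021, proof of Thm. 12, with abstract
gain `g`, rate `r` and a uniform per-level loss bound `B < g`): `h₀ = x_{(0,0)}` on a `1 × b` matrix and
`h_{j+1} = h_j ∘ H_j^{r^j}` re-blocked to an `r^{j+1} × b` matrix; level `j` is non-constant, needs KW depth
`≥ j·g − j·B`, and has a `B₂`-program of `≤ j · r^j · b · univBound(r·b)` gates. -/
theorem iterate_levels_vec {c r b g d B : ℕ}
    (hdoor : ∀ q : ℕ, ∀ f : (Fin q × Fin b → Bool) → Bool, (∃ x y, f x ≠ f y) →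
      ∃ H : (Fin (r * b) → Bool) → (Fin b → Bool), ∀ P : KWTree (Fin q × Fin (r * b)),
        P.Solves (vecComp f H) →
          ∃ Q : KWTree (Fin q × Fin b), Q.Solves f ∧ Q.depth + g ≤ P.depth + c * (Nat.log 2 (q * (r * b)) + 1))
    (hr : 1 ≤ r) (hb : 1 ≤ b)
    (hloss : ∀ j : ℕ, j < d → c * (Nat.log 2 (r ^ j * (r * b)) + 1) ≤ B) (hB : B < g) :
    ∀ j : ℕ, j ≤ d → ∃ h : (Fin (r ^ j) × Fin b → Bool) → Bool,
      (∃ x y, h x ≠ h y) ∧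
      (∀ Q : KWTree (Fin (r ^ j) × Fin b), Q.Solves h → j * g ≤ Q.depth + j * B) ∧
      CktSize B2 (fun x (_ : Unit) => h x) (j * (r ^ j * b * univBound (r * b)))
  | 0, _ => by
    have h1 : 0 < r ^ 0 := by simp
    have hb0 : 0 < b := hb
    refine ⟨fun x => x (⟨0, h1⟩, ⟨0, hb0⟩),
      ⟨fun _ => true, fun _ => false, by simp⟩, fun Q _ => by simp, ?_⟩
    simpa using CktSize.proj B2 (fun _ : Unit => ((⟨0, h1⟩, ⟨0, hb0⟩) : Fin (r ^ 0) × Fin b))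
  | j + 1, hj => by
    obtain ⟨h, hnc, hlb, hck⟩ := iterate_levels_vec hdoor hr hb hloss hB j (Nat.le_of_succ_le hj)
    obtain ⟨H, hH⟩ := hdoor (r ^ j) h hnc
    -- re-blocking `r^j × (r·b) ≃ r^(j+1) × b` (any bijection will do)
    have hcard : Fintype.card (Fin (r ^ j) × Fin (r * b)) = Fintype.card (Fin (r ^ (j + 1)) × Fin b) := by
      simp only [Fintype.card_prod, Fintype.card_fin, pow_succ]; ring
    let e : Fin (r ^ j) × Fin (r * b) ≃ Fin (r ^ (j + 1)) × Fin b := Fintype.equivOfCardEq hcard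
    -- the new function
    let h' : (Fin (r ^ (j + 1)) × Fin b → Bool) → Bool := fun z => vecComp h H (fun i => z (e i))
    have hlossj : c * (Nat.log 2 (r ^ j * (r * b)) + 1) ≤ B := hloss j hj
    -- (LB)
    have hlb' : ∀ Q : KWTree (Fin (r ^ (j + 1)) × Fin b), Q.Solves h' →
        (j + 1) * g ≤ Q.depth + (j + 1) * B := by
      intro Q hQ
      obtain ⟨P, hP, hPd⟩ := exists_solves_of_reindex e (vecComp h H) Q hQ
      obtain ⟨Q₀, hQ₀, hd⟩ := hH P hP
      have ih := hlb Q₀ hQ₀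
      rw [hPd] at hd
      rw [Nat.succ_mul, Nat.succ_mul]
      generalize c * (Nat.log 2 (r ^ j * (r * b)) + 1) = B' at hd hlossj
      generalize j * g = jg at ih ⊢
      generalize j * B = jB at ih ⊢
      omega
    -- (NC)
    have hnc' : ∃ x y, h' x ≠ h' y := by
      by_contra hall
      have hpos : 0 < r ^ (j + 1) := Nat.pow_pos hr
      have hsol := solves_of_forall_eq (KWTree.leaf ((⟨0, hpos⟩, ⟨0, hb⟩) : Fin (r ^ (j + 1)) × Fin b))
        (h := h') (fun x y => by by_contra hxy; exact hall ⟨x, y, hxy⟩)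
      have h1 := hlb' _ hsol
      rw [KWTree.depth_leaf, zero_add] at h1
      have h2 : g ≤ B := Nat.le_of_mul_le_mul_left h1 (Nat.succ_pos j)
      omega
    -- (CKT) one universal circuit per (row, output bit) for the gadget layer, then the program for `h`
    have hF : CktSize B2 (fun (x : Fin (r ^ j) × Fin (r * b) → Bool) (p : Fin (r ^ j) × Fin b) =>
        H (fun l => x (p.1, l)) p.2) (r ^ j * b * univBound (r * b)) := by
      have := CktSize.pi_const (κ := Fin (r ^ j) × Fin b)
        (f := fun (x : Fin (r ^ j) × Fin (r * b) → Bool) (p : Fin (r ^ j) × Fin b) => H (fun l => x (p.1, l)) p.2)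
        (fun p => (cktSize_univ_fin (r * b) (fun y (_ : Unit) => H y p.2)).rewire (fun l => (p.1, l)))
      simpa [Fintype.card_prod, Fintype.card_fin] using this
    have hck' : CktSize B2 (fun z (_ : Unit) => h' z) (r ^ j * b * univBound (r * b) + j * (r ^ j * b * univBound (r * b))) := by
      have h1 := (hF.comp hck).congr (g := fun x (_ : Unit) => vecComp h H x) fun x _ => rfl
      exact h1.rewire e
    refine ⟨h', hnc', hlb', hck'.of_le ?_⟩
    have hmono : r ^ j * b * univBound (r * b) ≤ r ^ (j + 1) * b * univBound (r * b) := by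
      have : r ^ j ≤ r ^ (j + 1) := Nat.pow_le_pow_right hr (Nat.le_succ j)
      exact Nat.mul_le_mul_right _ (Nat.mul_le_mul_right _ this)
    calc r ^ j * b * univBound (r * b) + j * (r ^ j * b * univBound (r * b))
        = (j + 1) * (r ^ j * b * univBound (r * b)) := by ring
      _ ≤ (j + 1) * (r ^ (j + 1) * b * univBound (r * b)) := Nat.mul_le_mul_left _ hmono


/-! ### The threshold: any gain with `G(b)²/b → ∞` at a fixed rate separates `P` from `NC¹` -/

/-- `t² ≤ 2^t` for `t ≥ 4`. -/
theorem sq_le_two_pow {t : ℕ} (ht : 4 ≤ t) : t * t ≤ 2 ^ t := by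
  induction t, ht using Nat.le_induction with
  | base => norm_num
  | succ t ht ih =>
    have h3 : 2 * t + 1 ≤ t * t := by nlinarith
    rw [pow_succ]
    nlinarith

/-- **Hard functions from a vector-gadget door** (the scale bookkeeping).  With `c₁ = c + 1`,
`w = ⌊log₂ r⌋ + 1`, `b = 2^t ≥ b₀(A)`, `g = G(b)`, `E = ⌊g / 4c₁w⌋` and `d = E − 1` levels, the function
`h_d` on `N = r^d · b` bits has a `B₂`-circuit `C` with `⌊log₂(N + |C|)⌋ ≤ 4S`, `S = r·b + E·w + t`, and KW
depth `> c₀ · S` — because the per-level loss is only `c₁((j+1)w + t) ≤ c₁(Ew + t) ≤ g/2` (the rate `r` is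
FIXED, so the outer arity contributes `w` per level, not `log b`), and `E · g/2 ≳ g²/(c₁ w) ≫ c₀ (r b + …)` as
soon as `g² ≥ A·b`. -/
theorem exists_hard_function_of_vecGain {c r : ℕ} {G : ℕ → ℕ} (hr : 1 ≤ r) (hG : SqrtGain r G)
    (hdoor : ∀ q b : ℕ, 1 ≤ b → ∀ f : (Fin q × Fin b → Bool) → Bool, (∃ x y, f x ≠ f y) →
      ∃ H : (Fin (r * b) → Bool) → (Fin b → Bool), ∀ P : KWTree (Fin q × Fin (r * b)),
        P.Solves (vecComp f H) →
          ∃ Q : KWTree (Fin q × Fin b), Q.Solves f ∧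
            Q.depth + G b ≤ P.depth + c * (Nat.log 2 (q * (r * b)) + 1))
    (c₀ : ℕ) :
    ∃ N : ℕ, 1 ≤ N ∧ ∃ h : (Fin N → Bool) → Bool, ∃ C : Circuit (Fin N),
      C.IsOver B2 ∧ C.Computes h ∧ ∃ S : ℕ, 1 ≤ S ∧ Nat.log 2 (N + C.size) ≤ 4 * S ∧
        ∀ P : KWTree (Fin N), P.Solves h → c₀ * S < P.depth := by
  -- WLOG the loss constant is positive
  set c₁ : ℕ := c + 1 with hc₁
  have hc₁1 : 1 ≤ c₁ := by omega
  have hdoor₁ : ∀ q b : ℕ, 1 ≤ b → ∀ f : (Fin q × Fin b → Bool) → Bool, (∃ x y, f x ≠ f y) →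
      ∃ H : (Fin (r * b) → Bool) → (Fin b → Bool), ∀ P : KWTree (Fin q × Fin (r * b)),
        P.Solves (vecComp f H) →
          ∃ Q : KWTree (Fin q × Fin b), Q.Solves f ∧
            Q.depth + G b ≤ P.depth + c₁ * (Nat.log 2 (q * (r * b)) + 1) := by
    intro q b hb f hf
    obtain ⟨H, hH⟩ := hdoor q b hb f hf
    refine ⟨H, fun P hP => ?_⟩
    obtain ⟨Q, hQ, hQd⟩ := hH P hP
    exact ⟨Q, hQ, hQd.trans (Nat.add_le_add_left (Nat.mul_le_mul_right _ (Nat.le_succ c)) _)⟩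
  -- the rate's logarithm `w`: `r < 2^w`
  set w : ℕ := Nat.log 2 r + 1 with hw
  have hw1 : 1 ≤ w := by omega
  have hrw : r < 2 ^ w := Nat.lt_pow_succ_log_self one_lt_two r
  -- the scale
  set A : ℕ := 4 * c₁ * w * ((3 * c₀ + 3) * r) + 16 * (c₁ * c₁) with hA
  obtain ⟨b₀, hb₀⟩ := hG.2 A
  set t : ℕ := b₀ + 4 with htdef
  set b : ℕ := 2 ^ t with hbdef
  have htb : t ≤ b := (Nat.lt_two_pow_self).le
  have hbb₀ : b₀ ≤ b := by omega
  have hb1 : 1 ≤ b := Nat.one_le_two_pow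
  have ht4 : 4 ≤ t := by omega
  set g : ℕ := G b with hgdef
  have hcap : g ≤ r * b := hG.1 b
  have hAg : A * b ≤ g * g := hb₀ b hbb₀
  have hrb1 : 1 ≤ r * b := Nat.one_le_iff_ne_zero.mpr (by positivity)
  -- `g > 0`
  have hg0 : 0 < g := by
    rcases Nat.eq_zero_or_pos g with h0 | h0
    · exfalso
      rw [h0] at hAg
      have h16 : 16 ≤ A := by
        have : 1 ≤ c₁ * c₁ := Nat.one_le_iff_ne_zero.mpr (by positivity)
        omega
      have : 16 ≤ A * b := h16.trans (Nat.le_mul_of_pos_right A hb1)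
      omega
    · exact h0
  -- `A ≤ g r`, hence `4 c₁ w (3c₀ + 3) ≤ g`
  have hAgr : A ≤ g * r := by
    have h1 : A * b ≤ (g * r) * b := by
      calc A * b ≤ g * g := hAg
        _ ≤ g * (r * b) := Nat.mul_le_mul_left g hcap
        _ = g * r * b := by ring
    exact Nat.le_of_mul_le_mul_right h1 hb1
  have hg1 : 4 * c₁ * w * (3 * c₀ + 3) ≤ g := by
    have h1 : 4 * c₁ * w * (3 * c₀ + 3) * r ≤ g * r := by
      calc 4 * c₁ * w * (3 * c₀ + 3) * r = 4 * c₁ * w * ((3 * c₀ + 3) * r) := by ring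
        _ ≤ A := Nat.le_add_right _ _
        _ ≤ g * r := hAgr
    exact Nat.le_of_mul_le_mul_right h1 hr
  -- `4 c₁ t ≤ g` via `t² ≤ 2^t`
  have hgt : 4 * c₁ * t ≤ g := by
    have h1 : (4 * c₁ * t) * (4 * c₁ * t) ≤ g * g := by
      calc (4 * c₁ * t) * (4 * c₁ * t) = 16 * (c₁ * c₁) * (t * t) := by ring
        _ ≤ 16 * (c₁ * c₁) * 2 ^ t := Nat.mul_le_mul_left _ (sq_le_two_pow ht4)
        _ = 16 * (c₁ * c₁) * b := by rw [hbdef]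
        _ ≤ A * b := Nat.mul_le_mul_right _ (Nat.le_add_left _ _)
        _ ≤ g * g := hAg
    exact Nat.mul_self_le_mul_self_iff.mp h1
  -- the number of levels `d = E - 1`, `E = ⌊g / 4c₁w⌋`
  set E : ℕ := g / (4 * c₁ * w) with hEdef
  have hden : 0 < 4 * c₁ * w := by positivity
  have hi : 4 * c₁ * w * E ≤ g := by rw [hEdef, mul_comm]; exact Nat.div_mul_le_self g _
  have hii : g < 4 * c₁ * w * (E + 1) := by
    rw [hEdef, mul_add_one, mul_comm]
    exact Nat.lt_div_mul_add hden
  have hE1 : 1 ≤ E := by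
    rw [hEdef]
    apply (Nat.le_div_iff_mul_le hden).mpr
    rw [one_mul]
    exact (Nat.le_mul_of_pos_right _ (by omega)).trans hg1
  set d : ℕ := E - 1 with hddef
  have hdE : d + 1 = E := by omega
  -- the uniform per-level loss bound `B = c₁ (E w + t) < g`
  set B : ℕ := c₁ * (E * w + t) with hBdef
  have hB : B < g := by
    have e1 : 4 * B = 4 * c₁ * w * E + 4 * c₁ * t := by rw [hBdef]; ring
    omega
  have hloss : ∀ j : ℕ, j < d → c₁ * (Nat.log 2 (r ^ j * (r * b)) + 1) ≤ B := by
    intro j hj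
    have hx0 : r ^ j * (r * b) ≠ 0 := by positivity
    have hlt : r ^ j * (r * b) < 2 ^ ((j + 1) * w + t) := by
      have h1 : r ^ (j + 1) < (2 ^ w) ^ (j + 1) := Nat.pow_lt_pow_left hrw (Nat.succ_ne_zero j)
      calc r ^ j * (r * b) = r ^ (j + 1) * b := by ring
        _ < (2 ^ w) ^ (j + 1) * b := Nat.mul_lt_mul_of_pos_right h1 (by omega)
        _ = (2 ^ w) ^ (j + 1) * 2 ^ t := by rw [hbdef]
        _ = 2 ^ ((j + 1) * w + t) := by ring
    have hlog : Nat.log 2 (r ^ j * (r * b)) < (j + 1) * w + t :=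
      (Nat.log_lt_iff_lt_pow one_lt_two hx0).mpr hlt
    have hjw : (j + 1) * w ≤ E * w := Nat.mul_le_mul_right w (by omega)
    rw [hBdef]
    exact Nat.mul_le_mul_left c₁ (by omega)
  -- the tower, `d` levels, at the fixed gadget width `b`
  obtain ⟨h, hnc, hlb, hck⟩ :=
    iterate_levels_vec (c := c₁) (g := g) (d := d) (B := B)
      (fun q f hf => hdoor₁ q b hb1 f hf) hr hb1 hloss hB d le_rfl
  -- flatten `Fin (r^d) × Fin b ≃ Fin N`
  set N : ℕ := r ^ d * b with hNdef
  let e : Fin (r ^ d) × Fin b ≃ Fin N := finProdFinEquiv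
  let hN : (Fin N → Bool) → Bool := fun x => h (fun p => x (e p))
  obtain ⟨C, hCO, hCs, hCe⟩ := (hck.rewire e).toCircuit
  have hN1 : 1 ≤ N := by rw [hNdef]; exact Nat.one_le_iff_ne_zero.mpr (by positivity)
  refine ⟨N, hN1, hN, C, hCO, fun x => hCe x, r * b + (E * w + t), by omega, ?_, fun P hP => ?_⟩
  · -- `N + |C| ≤ r^d b (1 + d · univBound (r b)) ≤ 2^(w d) · 2^t · 2^d · 2^(r b + 3)`
    have hU : univBound (r * b) ≤ 2 ^ (r * b + 3) :=
      Literature.Computability.MetaComplexity.Hirahara2020.univBound_le_two_pow (r * b)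
    have hd2 : d + 1 ≤ 2 ^ d := Nat.lt_two_pow_self
    have hrd : r ^ d ≤ 2 ^ (w * d) := by
      calc r ^ d ≤ (2 ^ w) ^ d := Nat.pow_le_pow_left hrw.le d
        _ = 2 ^ (w * d) := (pow_mul 2 w d).symm
    have hNle : N ≤ 2 ^ (w * d + t) := by
      calc N = r ^ d * 2 ^ t := by rw [hNdef, hbdef]
        _ ≤ 2 ^ (w * d) * 2 ^ t := Nat.mul_le_mul_right _ hrd
        _ = 2 ^ (w * d + t) := by ring
    have h1 : N + C.size ≤ N * (1 + d * univBound (r * b)) := by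
      have eN : N * (1 + d * univBound (r * b)) = N + d * (N * univBound (r * b)) := by ring
      rw [eN]
      exact Nat.add_le_add_left hCs N
    have h2 : 1 + d * univBound (r * b) ≤ 2 ^ d * 2 ^ (r * b + 3) := by
      have h21 : 1 + d * univBound (r * b) ≤ (d + 1) * 2 ^ (r * b + 3) := by
        have h8 : 1 ≤ 2 ^ (r * b + 3) := Nat.one_le_two_pow
        have hdU : d * univBound (r * b) ≤ d * 2 ^ (r * b + 3) := Nat.mul_le_mul_left d hU
        have e' : (d + 1) * 2 ^ (r * b + 3) = d * 2 ^ (r * b + 3) + 2 ^ (r * b + 3) := by ring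
        rw [e']
        omega
      exact h21.trans (Nat.mul_le_mul_right _ hd2)
    have h3 : N + C.size ≤ 2 ^ (w * d + t + d + (r * b + 3)) := by
      calc N + C.size ≤ N * (1 + d * univBound (r * b)) := h1
        _ ≤ 2 ^ (w * d + t) * (2 ^ d * 2 ^ (r * b + 3)) := Nat.mul_le_mul hNle h2
        _ = 2 ^ (w * d + t + d + (r * b + 3)) := by ring
    have I : w * d + w = E * w := by rw [← hdE]; ring
    have hdw : d ≤ w * d := Nat.le_mul_of_pos_left d hw1
    calc Nat.log 2 (N + C.size) ≤ Nat.log 2 (2 ^ (w * d + t + d + (r * b + 3))) := Nat.log_mono_right h3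
      _ = w * d + t + d + (r * b + 3) := Nat.log_pow (by norm_num) _
      _ ≤ 4 * (r * b + (E * w + t)) := by
          generalize w * d = WD at I hdw ⊢
          generalize E * w = EW at I ⊢
          generalize r * b = rb at hrb1 ⊢
          omega
  · -- depth: `d (g − B) > c₀ (r b + E w + t)`
    obtain ⟨P₀, hP₀, hP₀d⟩ := exists_solves_of_reindex e h P hP
    have h1 := hlb P₀ hP₀
    rw [hP₀d] at h1
    -- F1 : `3 (c₀ + 1) r b < (E + 1) g`  (from `A b ≤ g² < 4c₁w(E+1) g`)
    have F1 : 3 * (c₀ * (r * b)) + 3 * (r * b) < E * g + g := by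
      have h2 : A * b < 4 * c₁ * w * (E + 1) * g := by
        calc A * b ≤ g * g := hAg
          _ < 4 * c₁ * w * (E + 1) * g := Nat.mul_lt_mul_of_pos_right hii hg0
      have h3 : 4 * c₁ * w * ((3 * c₀ + 3) * (r * b)) < 4 * c₁ * w * ((E + 1) * g) := by
        calc 4 * c₁ * w * ((3 * c₀ + 3) * (r * b)) = (4 * c₁ * w * ((3 * c₀ + 3) * r)) * b := by ring
          _ ≤ A * b := Nat.mul_le_mul_right b (Nat.le_add_right _ _)
          _ < 4 * c₁ * w * (E + 1) * g := h2
          _ = 4 * c₁ * w * ((E + 1) * g) := by ring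
      have h4 := Nat.lt_of_mul_lt_mul_left h3
      have e1 : (3 * c₀ + 3) * (r * b) = 3 * (c₀ * (r * b)) + 3 * (r * b) := by ring
      have e2 : (E + 1) * g = E * g + g := by ring
      rw [e1, e2] at h4
      exact h4
    have F2 : 4 * (c₁ * (E * w)) ≤ g := by
      have e1 : 4 * (c₁ * (E * w)) = 4 * c₁ * w * E := by ring
      rw [e1]; exact hi
    have Ft : 4 * (c₁ * t) ≤ g := by
      have e1 : 4 * (c₁ * t) = 4 * c₁ * t := by ring
      rw [e1]; exact hgt
    have F3 : 4 * (E * (c₁ * (E * w))) ≤ E * g := by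
      have e1 : 4 * (E * (c₁ * (E * w))) = E * (4 * (c₁ * (E * w))) := by ring
      rw [e1]; exact Nat.mul_le_mul_left E F2
    have F3' : 4 * (E * (c₁ * t)) ≤ E * g := by
      have e1 : 4 * (E * (c₁ * t)) = E * (4 * (c₁ * t)) := by ring
      rw [e1]; exact Nat.mul_le_mul_left E Ft
    have I1 : d * g + g = E * g := by rw [← hdE]; ring
    have I2 : d * B + B = E * (c₁ * (E * w)) + E * (c₁ * t) := by rw [hBdef, ← hdE]; ring
    have hBsplit : B = c₁ * (E * w) + c₁ * t := by rw [hBdef]; ring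
    have F4 : c₀ * (E * w) ≤ c₀ * (c₁ * (E * w)) :=
      Nat.mul_le_mul_left c₀ (Nat.le_mul_of_pos_left _ hc₁1)
    have F4' : c₀ * t ≤ c₀ * (c₁ * t) := Nat.mul_le_mul_left c₀ (Nat.le_mul_of_pos_left _ hc₁1)
    have F5 : 4 * (c₀ * (c₁ * (E * w))) ≤ c₀ * g := by
      have e1 : 4 * (c₀ * (c₁ * (E * w))) = c₀ * (4 * (c₁ * (E * w))) := by ring
      rw [e1]; exact Nat.mul_le_mul_left c₀ F2
    have F5' : 4 * (c₀ * (c₁ * t)) ≤ c₀ * g := by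
      have e1 : 4 * (c₀ * (c₁ * t)) = c₀ * (4 * (c₁ * t)) := by ring
      rw [e1]; exact Nat.mul_le_mul_left c₀ Ft
    have F6 : c₀ * g ≤ c₀ * (r * b) := Nat.mul_le_mul_left c₀ hcap
    rw [mul_add, mul_add]
    generalize d * g = P₁ at h1 I1
    generalize d * B = P₂ at h1 I2
    rw [hBsplit] at I2
    generalize E * (c₁ * (E * w)) = Z₁ at F3 I2
    generalize E * (c₁ * t) = Z₂ at F3' I2
    generalize c₀ * (c₁ * (E * w)) = W₁ at F4 F5
    generalize c₀ * (c₁ * t) = W₃ at F4' F5'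
    generalize c₀ * (E * w) = W at F4 ⊢
    generalize c₀ * t = W₂ at F4' ⊢
    generalize c₁ * (E * w) = V at F2 I2 hBsplit
    generalize c₁ * t = T at Ft I2 hBsplit
    generalize E * g = X at F1 F3 F3' I1
    generalize c₀ * g = Ug at F5 F5' F6
    generalize c₀ * (r * b) = U at F1 F6 ⊢
    generalize r * b = rb at hcap F1 ⊢
    omega

/-- **Threshold theorem.**  A vector-gadget door of any FIXED rate `r ≥ 1` whose gain satisfies
`G(b)²/b → ∞` (and `G(b) ≤ r b`) puts a language of `P` outside non-uniform `NC¹`. -/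
theorem notNC1_of_vecGainKRW {r : ℕ} {G : ℕ → ℕ} (hr : 1 ≤ r) (hG : SqrtGain r G)
    (h : VecGainKRW r G) : ∃ L ∈ Classes.P, L ∉ NC1 := by
  obtain ⟨c, hc⟩ := h
  exact not_NC1_of_hardFunctions fun c₀ => exists_hard_function_of_vecGain hr hG hc c₀

/-- … hence, with the route's residual (R), `P ≠ NP`. -/
theorem pneNP_of_vecGainKRW {r : ℕ} {G : ℕ → ℕ} (hr : 1 ≤ r) (hG : SqrtGain r G) (h : VecGainKRW r G)
    (hR : Summit.PneNP.PneNP.Theses.KrwChromaticSteering.FormulaLayerLift) : PneNP := by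
  refine hR fun hsub => ?_
  obtain ⟨L, hLP, hLNC⟩ := notNC1_of_vecGainKRW hr hG h
  exact hLNC (hsub hLP)

/-- The XOR door at `m ≥ 1` copies with gain `G`, `G(k)²/k → ∞`, gives `P ⊄ NC¹`. -/
theorem notNC1_of_xorGainKRW {m : ℕ} {G : ℕ → ℕ} (hm : 1 ≤ m) (hG : SqrtGain m G)
    (h : XorGainKRW m G) : ∃ L ∈ Classes.P, L ∉ NC1 :=
  notNC1_of_vecGainKRW hm hG (vecGainKRW_of_xorGainKRW h)

/-- The fraction gain `k ↦ ⌊k/K⌋` satisfies the threshold hypothesis at every rate `r ≥ 1`. -/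
theorem sqrtGain_div {r K : ℕ} (hr : 1 ≤ r) (hK : 0 < K) : SqrtGain r (fun b => b / K) := by
  refine ⟨fun b => (Nat.div_le_self b K).trans (Nat.le_mul_of_pos_left b hr), fun A => ?_⟩
  refine ⟨4 * (K * K * A) + 2 * K, fun b hb => ?_⟩
  set q := b / K with hq
  have F1 : K * q + b % K = b := Nat.div_add_mod b K
  have F2 : b % K < K := Nat.mod_lt b hK
  have hKq : b - K ≤ K * q := by omega
  suffices h : K * K * (A * b) ≤ K * K * (q * q) from Nat.le_of_mul_le_mul_left h (by positivity)
  have e1 : K * K * (q * q) = (K * q) * (K * q) := by ring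
  rw [e1]
  have hn2 : 2 * K ≤ b := by omega
  calc K * K * (A * b) = b * (K * K * A) := by ring
    _ ≤ b * (b - 2 * K) := Nat.mul_le_mul_left b (by omega)
    _ ≤ (b - K) * (b - K) := by
        zify [hn2, (by omega : K ≤ b)]
        nlinarith
    _ ≤ (K * q) * (K * q) := Nat.mul_le_mul hKq hKq

/-- The lossless conjecture gives the gain form with loss constant `c = 0`. -/
theorem xorGainKRW_of_xorKRWConjecture (h : XorKRWConjecture) :
    ∃ m K : ℕ, 1 ≤ m ∧ 0 < K ∧ XorGainKRW m (fun k => k / K) := by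
  obtain ⟨m, K, hm, hK, hc⟩ := h
  refine ⟨m, K, hm, hK, 0, fun q k _ f hf => ?_⟩
  obtain ⟨g, hg⟩ := hc q k f hf
  refine ⟨g, fun P hP => ?_⟩
  obtain ⟨Q, hQ, hQd⟩ := hg P hP
  exact ⟨Q, hQ, hQd.trans (Nat.le_add_right _ _)⟩

/-- **Mihajlin–Smal 2021, Theorem 12, kernel-checked**: the XOR-KRW conjecture implies `P ⊄ NC¹`
(non-uniform `NC¹`; the language is the circuit-value language of `Theorems.CompositionIteration_proof`). -/
theorem notNC1_of_xorKRWConjecture (h : XorKRWConjecture) : ∃ L ∈ Classes.P, L ∉ NC1 := by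
  obtain ⟨m, K, hm, hK, hx⟩ := xorGainKRW_of_xorKRWConjecture h
  exact notNC1_of_xorGainKRW hm (sqrtGain_div hm hK) hx

/-- … hence, with the route's residual (R), `P ≠ NP`. -/
theorem pneNP_of_xorKRWConjecture (h : XorKRWConjecture)
    (hR : Summit.PneNP.PneNP.Theses.KrwChromaticSteering.FormulaLayerLift) : PneNP := by
  refine hR fun hsub => ?_
  obtain ⟨L, hLP, hLNC⟩ := notNC1_of_xorKRWConjecture h
  exact hLNC (hsub hLP)

/-! ### The lossless form: ANY unbounded gain suffices (Mihajlin–Smal's Theorem 12 sharpened) -/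

/-- **Lossless vector-gadget door** (no logarithmic loss term, as in the printed XOR-KRW conjecture):
every protocol for `KW_{f ∘ H^q}` yields a `KW_f`-protocol shorter by the full `G(b)`.  OPEN for unbounded `G`. -/
@[conjecture] def VecKRWLossless (r : ℕ) (G : ℕ → ℕ) : Prop :=
  ∀ q b : ℕ, 1 ≤ b → ∀ f : (Fin q × Fin b → Bool) → Bool, (∃ x y, f x ≠ f y) →
    ∃ H : (Fin (r * b) → Bool) → (Fin b → Bool), ∀ P : KWTree (Fin q × Fin (r * b)),
      P.Solves (vecComp f H) → ∃ Q : KWTree (Fin q × Fin b), Q.Solves f ∧ Q.depth + G b ≤ P.depth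

/-- Without a loss term the number of levels is FREE: fix one width `b` with `G(b) > c₀ · (⌊log₂ r⌋ + 1)` and
iterate `d = c₀ (r b + ⌊log₂ b⌋ + 1) + 1` times. -/
theorem exists_hard_function_of_lossless {r : ℕ} {G : ℕ → ℕ} (hr : 1 ≤ r)
    (hG : ∀ M : ℕ, ∃ b, 1 ≤ b ∧ M ≤ G b) (hdoor : VecKRWLossless r G) (c₀ : ℕ) :
    ∃ N : ℕ, 1 ≤ N ∧ ∃ h : (Fin N → Bool) → Bool, ∃ C : Circuit (Fin N),
      C.IsOver B2 ∧ C.Computes h ∧ ∃ S : ℕ, 1 ≤ S ∧ Nat.log 2 (N + C.size) ≤ 4 * S ∧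
        ∀ P : KWTree (Fin N), P.Solves h → c₀ * S < P.depth := by
  set w : ℕ := Nat.log 2 r + 1 with hw
  have hw1 : 1 ≤ w := by omega
  have hrw : r < 2 ^ w := Nat.lt_pow_succ_log_self one_lt_two r
  obtain ⟨b, hb1, hgb⟩ := hG (c₀ * w + 1)
  set g : ℕ := G b with hgdef
  set t : ℕ := Nat.log 2 b + 1 with htdef
  have hbt : b < 2 ^ t := Nat.lt_pow_succ_log_self one_lt_two b
  have hrb1 : 1 ≤ r * b := Nat.one_le_iff_ne_zero.mpr (by positivity)
  set d : ℕ := c₀ * (r * b + t) + 1 with hddef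
  have hdoor0 : ∀ q : ℕ, ∀ f : (Fin q × Fin b → Bool) → Bool, (∃ x y, f x ≠ f y) →
      ∃ H : (Fin (r * b) → Bool) → (Fin b → Bool), ∀ P : KWTree (Fin q × Fin (r * b)),
        P.Solves (vecComp f H) →
          ∃ Q : KWTree (Fin q × Fin b), Q.Solves f ∧
            Q.depth + g ≤ P.depth + 0 * (Nat.log 2 (q * (r * b)) + 1) := by
    intro q f hf
    obtain ⟨H, hH⟩ := hdoor q b hb1 f hf
    refine ⟨H, fun P hP => ?_⟩
    obtain ⟨Q, hQ, hd⟩ := hH P hP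
    exact ⟨Q, hQ, by simpa using hd⟩
  have hloss : ∀ j : ℕ, j < d → 0 * (Nat.log 2 (r ^ j * (r * b)) + 1) ≤ 0 := fun j _ => by simp
  have hB : 0 < g := by omega
  obtain ⟨h, hnc, hlb, hck⟩ :=
    iterate_levels_vec (c := 0) (g := g) (d := d) (B := 0) hdoor0 hr hb1 hloss hB d le_rfl
  set N : ℕ := r ^ d * b with hNdef
  let e : Fin (r ^ d) × Fin b ≃ Fin N := finProdFinEquiv
  let hN : (Fin N → Bool) → Bool := fun x => h (fun p => x (e p))
  obtain ⟨C, hCO, hCs, hCe⟩ := (hck.rewire e).toCircuit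
  have hN1 : 1 ≤ N := by rw [hNdef]; exact Nat.one_le_iff_ne_zero.mpr (by positivity)
  refine ⟨N, hN1, hN, C, hCO, fun x => hCe x, r * b + (d * w + t), by omega, ?_, fun P hP => ?_⟩
  · have hU : univBound (r * b) ≤ 2 ^ (r * b + 3) :=
      Literature.Computability.MetaComplexity.Hirahara2020.univBound_le_two_pow (r * b)
    have hd2 : d + 1 ≤ 2 ^ d := Nat.lt_two_pow_self
    have hrd : r ^ d ≤ 2 ^ (w * d) := by
      calc r ^ d ≤ (2 ^ w) ^ d := Nat.pow_le_pow_left hrw.le d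
        _ = 2 ^ (w * d) := (pow_mul 2 w d).symm
    have hNle : N ≤ 2 ^ (w * d + t) := by
      calc N = r ^ d * b := by rw [hNdef]
        _ ≤ 2 ^ (w * d) * 2 ^ t := Nat.mul_le_mul hrd hbt.le
        _ = 2 ^ (w * d + t) := by ring
    have h1 : N + C.size ≤ N * (1 + d * univBound (r * b)) := by
      have eN : N * (1 + d * univBound (r * b)) = N + d * (N * univBound (r * b)) := by ring
      rw [eN]
      exact Nat.add_le_add_left hCs N
    have h2 : 1 + d * univBound (r * b) ≤ 2 ^ d * 2 ^ (r * b + 3) := by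
      have h21 : 1 + d * univBound (r * b) ≤ (d + 1) * 2 ^ (r * b + 3) := by
        have h8 : 1 ≤ 2 ^ (r * b + 3) := Nat.one_le_two_pow
        have hdU : d * univBound (r * b) ≤ d * 2 ^ (r * b + 3) := Nat.mul_le_mul_left d hU
        have e' : (d + 1) * 2 ^ (r * b + 3) = d * 2 ^ (r * b + 3) + 2 ^ (r * b + 3) := by ring
        rw [e']
        omega
      exact h21.trans (Nat.mul_le_mul_right _ hd2)
    have h3 : N + C.size ≤ 2 ^ (w * d + t + d + (r * b + 3)) := by
      calc N + C.size ≤ N * (1 + d * univBound (r * b)) := h1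
        _ ≤ 2 ^ (w * d + t) * (2 ^ d * 2 ^ (r * b + 3)) := Nat.mul_le_mul hNle h2
        _ = 2 ^ (w * d + t + d + (r * b + 3)) := by ring
    have hdw : d ≤ w * d := Nat.le_mul_of_pos_left d hw1
    have I : w * d = d * w := mul_comm w d
    calc Nat.log 2 (N + C.size) ≤ Nat.log 2 (2 ^ (w * d + t + d + (r * b + 3))) := Nat.log_mono_right h3
      _ = w * d + t + d + (r * b + 3) := Nat.log_pow (by norm_num) _
      _ ≤ 4 * (r * b + (d * w + t)) := by
          generalize w * d = WD at I hdw ⊢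
          generalize d * w = DW at I ⊢
          generalize r * b = rb at hrb1 ⊢
          omega
  · obtain ⟨P₀, hP₀, hP₀d⟩ := exists_solves_of_reindex e h P hP
    have h1 := hlb P₀ hP₀
    rw [hP₀d, mul_zero, add_zero] at h1
    have F1 : d * (c₀ * w + 1) ≤ d * g := Nat.mul_le_mul_left d hgb
    have e1 : d * (c₀ * w + 1) = c₀ * (d * w) + d := by ring
    rw [e1] at F1
    have hd' : d = c₀ * (r * b) + c₀ * t + 1 := by rw [hddef]; ring
    rw [mul_add, mul_add]
    generalize c₀ * (d * w) = A1 at F1 ⊢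
    generalize d * g = DG at F1 h1
    generalize c₀ * (r * b) = U at hd' ⊢
    generalize c₀ * t = V at hd' ⊢
    omega

/-- **Lossless, any unbounded gain suffices**: a lossless vector-gadget door of a fixed rate `r ≥ 1` with
`G(b) → ∞` (however slowly) puts a language of `P` outside non-uniform `NC¹`. -/
theorem notNC1_of_vecKRWLossless {r : ℕ} {G : ℕ → ℕ} (hr : 1 ≤ r) (hG : ∀ M : ℕ, ∃ b, 1 ≤ b ∧ M ≤ G b)
    (h : VecKRWLossless r G) : ∃ L ∈ Classes.P, L ∉ NC1 :=
  not_NC1_of_hardFunctions fun c₀ => exists_hard_function_of_lossless hr hG h c₀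

/-- **Mihajlin–Smal's Theorem 12 sharpened**: in the XOR-KRW conjecture the gain `εk` may be replaced by ANY
unbounded `γ(k) → ∞` — `D(f ⊞ₘ g) ≥ D(f) + γ(k)` for all non-constant `f` and some `g` still gives `P ⊄ NC¹`
(the number of levels of the tower is free when the composition is lossless). -/
theorem notNC1_of_xorKRW_unboundedGain {m : ℕ} {G : ℕ → ℕ} (hm : 1 ≤ m)
    (hG : ∀ M : ℕ, ∃ k, 1 ≤ k ∧ M ≤ G k)
    (h : ∀ q k : ℕ, 1 ≤ k → ∀ f : (Fin q × Fin k → Bool) → Bool, (∃ x y, f x ≠ f y) →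
      ∃ g : (Fin k → Bool) → (Fin k → Bool), ∀ P : KWTree (Fin q × Fin (m * k)),
        P.Solves (vecComp f (xorGadget m g)) →
          ∃ Q : KWTree (Fin q × Fin k), Q.Solves f ∧ Q.depth + G k ≤ P.depth) :
    ∃ L ∈ Classes.P, L ∉ NC1 :=
  notNC1_of_vecKRWLossless hm hG fun q k hk f hf => by
    obtain ⟨g, hg⟩ := h q k hk f hf
    exact ⟨xorGadget m g, hg⟩

/-- Second proof of Theorem 12 through the lossless route (calibration of the two bookkeepings). -/
theorem notNC1_of_xorKRWConjecture' (h : XorKRWConjecture) : ∃ L ∈ Classes.P, L ∉ NC1 := by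
  obtain ⟨m, K, hm, hK, hc⟩ := h
  refine notNC1_of_xorKRW_unboundedGain (G := fun k => k / K) hm (fun M => ?_) (fun q k _ f hf => hc q k f hf)
  refine ⟨M * K + K, by nlinarith, ?_⟩
  show M ≤ (M * K + K) / K
  rw [show M * K + K = (M + 1) * K by ring, Nat.mul_div_cancel _ hK]
  omega

/-! ### Calibration: rate 1 collapses (the edge `m = 1` of the XOR door is FALSE) -/

/-- The optimal KW depth of `f` (`0` if no protocol exists, which happens only over an empty index). -/
noncomputable def optDepth {ι : Type u} (f : (ι → Bool) → Bool) : ℕ :=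
  sInf {d | ∃ P : KWTree ι, P.Solves f ∧ P.depth = d}

theorem optDepth_le {ι : Type u} {f : (ι → Bool) → Bool} (P : KWTree ι) (hP : P.Solves f) :
    optDepth f ≤ P.depth :=
  Nat.sInf_le ⟨P, hP, rfl⟩

theorem exists_solves_depth_eq_optDepth {ι : Type u} {f : (ι → Bool) → Bool} (h : ∃ P : KWTree ι, P.Solves f) :
    ∃ P : KWTree ι, P.Solves f ∧ P.depth = optDepth f := by
  have hne : {d | ∃ P : KWTree ι, P.Solves f ∧ P.depth = d}.Nonempty := by
    obtain ⟨P, hP⟩ := h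
    exact ⟨P.depth, P, hP, rfl⟩
  exact Nat.sInf_mem hne

/-- Every function on a non-empty `q × b` matrix has SOME KW protocol (transport of
`Negative.NoFiniteRefutation.exists_solves_sendInput`). -/
theorem exists_solves_matrix {q b : ℕ} (hqb : 1 ≤ q * b) (f : (Fin q × Fin b → Bool) → Bool) :
    ∃ P : KWTree (Fin q × Fin b), P.Solves f := by
  obtain ⟨R, hR, -⟩ :=
    Summit.PneNP.PneNP.Theorems.StrongComposition.Negative.NoFiniteRefutation.exists_solves_sendInput hqb
      (fun z => f (fun i => z (finProdFinEquiv i)))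
  obtain ⟨P, hP, -⟩ := exists_solves_of_reindex finProdFinEquiv f R hR
  exact ⟨P, hP⟩

open Classical in
/-- **Rate 1 collapses.**  `VecGainKRW 1 G` is FALSE as soon as `G(b) > c(⌊log₂ b⌋ + 1)` happens for every
`c` (e.g. any unbounded `G(b)/log b`): take `q = 1` and a non-constant `f` on a `1 × b` matrix of MAXIMAL
optimal KW depth `D`; for any `H : {0,1}^b → {0,1}^b` the composed `f ∘ H` is again a function on `b` bits, so
it has a protocol of depth `≤ D` (or is constant: depth `0`), and the door would return a `KW_f`-protocol of
depth `≤ D + c(⌊log₂ b⌋+1) − G(b) < D`.  (Block-wise: `(f ∘ g₁^q) ∘ g₂^q = f ∘ (g₁ ∘ g₂)^q` — with rate 1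
iteration never leaves width `b`.)  Hence `m ≥ 2` copies are NECESSARY in the XOR-KRW conjecture. -/
theorem not_vecGainKRW_one {G : ℕ → ℕ} (hG : ∀ c : ℕ, ∃ b, 1 ≤ b ∧ c * (Nat.log 2 b + 1) < G b) :
    ¬ VecGainKRW 1 G := by
  rintro ⟨c, hc⟩
  obtain ⟨b, hb, hcb⟩ := hG c
  -- non-constant functions on a `1 × b` matrix, and one of maximal optimal depth
  have hsol : ∀ f : (Fin 1 × Fin b → Bool) → Bool, ∃ P : KWTree (Fin 1 × Fin b), P.Solves f :=
    fun f => exists_solves_matrix (by omega) f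
  set NC : Finset ((Fin 1 × Fin b → Bool) → Bool) := Finset.univ.filter fun f => ∃ x y, f x ≠ f y with hNCdef
  have hNC : NC.Nonempty := by
    refine ⟨fun x => x (⟨0, Nat.one_pos⟩, ⟨0, hb⟩), ?_⟩
    rw [hNCdef, Finset.mem_filter]
    exact ⟨Finset.mem_univ _, fun _ => true, fun _ => false, by simp⟩
  obtain ⟨f₁, hf₁NC, hmax⟩ := Finset.exists_max_image NC optDepth hNC
  have hf₁ : ∃ x y, f₁ x ≠ f₁ y := by
    rw [hNCdef, Finset.mem_filter] at hf₁NC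
    exact hf₁NC.2
  -- the door at `q = 1`
  obtain ⟨H, hH⟩ := hc 1 b hb f₁ hf₁
  -- the composed function lives on `Fin 1 × Fin (1 * b)`; move it to `Fin 1 × Fin b`
  let e : Fin 1 × Fin (1 * b) ≃ Fin 1 × Fin b := Equiv.prodCongr (Equiv.refl _) (finCongr (Nat.one_mul b))
  let f₂ : (Fin 1 × Fin b → Bool) → Bool := fun z => vecComp f₁ H (fun i => z (e i))
  have key : ∃ P : KWTree (Fin 1 × Fin (1 * b)), P.Solves (vecComp f₁ H) ∧ P.depth ≤ optDepth f₁ := by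
    by_cases h2 : ∃ x y, f₂ x ≠ f₂ y
    · have hmem : f₂ ∈ NC := by
        rw [hNCdef, Finset.mem_filter]
        exact ⟨Finset.mem_univ _, h2⟩
      have hle : optDepth f₂ ≤ optDepth f₁ := hmax f₂ hmem
      obtain ⟨Q, hQ, hQd⟩ := exists_solves_depth_eq_optDepth (hsol f₂)
      obtain ⟨P, hP, hPd⟩ := exists_solves_of_reindex e (vecComp f₁ H) Q hQ
      exact ⟨P, hP, by rw [hPd, hQd]; exact hle⟩
    · push Not at h2
      have hconst : ∀ x y, vecComp f₁ H x = vecComp f₁ H y := by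
        intro x y
        have h3 := h2 (fun i => x (e.symm i)) (fun i => y (e.symm i))
        simpa [f₂] using h3
      exact ⟨KWTree.leaf (⟨0, Nat.one_pos⟩, ⟨0, by omega⟩), solves_of_forall_eq _ hconst, Nat.zero_le _⟩
  obtain ⟨P, hP, hPd⟩ := key
  obtain ⟨Q, hQ, hQd⟩ := hH P hP
  have hQopt : optDepth f₁ ≤ Q.depth := optDepth_le Q hQ
  have hlog : Nat.log 2 (1 * (1 * b)) = Nat.log 2 b := by rw [Nat.one_mul, Nat.one_mul]
  rw [hlog] at hQd
  omega

/-- Hence the XOR door with ONE copy is false for every gain outgrowing `c · log`. -/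
theorem not_xorGainKRW_one {G : ℕ → ℕ} (hG : ∀ c : ℕ, ∃ b, 1 ≤ b ∧ c * (Nat.log 2 b + 1) < G b) :
    ¬ XorGainKRW 1 G :=
  fun h => not_vecGainKRW_one hG (vecGainKRW_of_xorGainKRW h)

/-- In particular `m = 1` with the conjecture's own gain `k / K` is refuted. -/
theorem not_xorGainKRW_one_div {K : ℕ} (hK : 0 < K) : ¬ XorGainKRW 1 (fun k => k / K) := by
  apply not_xorGainKRW_one
  intro c
  obtain ⟨t, ht⟩ := exists_mul_succ_lt_two_pow (K * (c + 1))
  refine ⟨2 ^ t, Nat.one_le_two_pow, ?_⟩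
  rw [Nat.log_pow (by norm_num) t]
  have h1 : (c * (t + 1) + 1) * K ≤ 2 ^ t := by
    have e1 : K * (c + 1) * (t + 1) = c * (t + 1) * K + K * (t + 1) := by ring
    have e2 : (c * (t + 1) + 1) * K = c * (t + 1) * K + K := by ring
    have hK1 : K ≤ K * (t + 1) := Nat.le_mul_of_pos_right K (Nat.succ_pos t)
    rw [e1] at ht
    rw [e2]
    generalize c * (t + 1) * K = X at ht ⊢
    generalize K * (t + 1) = Y at ht hK1
    omega
  exact Nat.lt_of_lt_of_le (Nat.lt_succ_self _) ((Nat.le_div_iff_mul_le hK).mpr h1)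


/-! ### § Wu — the printed weakest open form sits BELOW the route's door (Wu 2024, Conjecture 1.2) -/

/-- **Wu's Conjecture 1.2** (H. Wu, arXiv:2404.15613, p.3: "we don't even know how to prove this weaker
conjecture … the closest answer is Meir's strong composition theorem, but we don't know how to prove it for the
case of standard composition" — i.e. exactly the route's C2 gap): for some constant `ε = 1/K > 0` there are —
typed here in the weakest reading, for INFINITELY MANY `n` — NON-CONSTANT `f, g : {0,1}^n → {0,1}` with
`D(f ⋄ g) ≥ (1 + ε)·n` (standard block composition, general protocols).  OPEN; by Wu it would break the `3 log n`
depth barrier for a modified Andreev function. [cite: Wu2024NearlyFourLog, Conj. 1.2] -/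
@[conjecture] def WuConjecture : Prop :=
  ∃ K : ℕ, 0 < K ∧ ∀ n₀ : ℕ, ∃ n : ℕ, n₀ ≤ n ∧ ∃ f g : (Fin n → Bool) → Bool,
    (∃ x y, f x ≠ f y) ∧ (∃ x y, g x ≠ g y) ∧
    ∀ P : KWTree (Fin n × Fin n), P.Solves (blockComp f g) → n + n / K ≤ P.depth

/-- **The route's door implies Wu's conjecture** (`ε = 1/2K` from the door's `1/K`): apply `WeakKRWFrac` at the
diagonal `m = n = 2^t` to a depth-hard outer function (`DepthHardFunctionsExist_holds`, Riordan–Shannon through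
Karchmer–Wigderson, landed in Literature): `D(f ⋄ g) ≥ (n − c'(t+1)) + n/K − c(2t+1) ≥ n + n/2K`. -/
theorem wuConjecture_of_weakKRWFrac (h : WeakKRWFrac) : WuConjecture := by
  obtain ⟨c, K, hK, hw⟩ := h
  obtain ⟨c', hhard⟩ := Literature.Computability.Complexity.DepthHardFunctionsExist_holds
  refine ⟨2 * K, by omega, fun n₀ => ?_⟩
  -- the scale `n = 2^t` with `(2K(c' + 2c + 1) + n₀)(t + 1) < 2^t`
  set M : ℕ := 2 * K * (c' + 2 * c + 1) + n₀ with hM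
  obtain ⟨t, ht⟩ := exists_mul_succ_lt_two_pow M
  set n : ℕ := 2 ^ t with hndef
  have hn1 : 1 ≤ n := Nat.one_le_two_pow
  have hlogn : Nat.log 2 n = t := Nat.log_pow (by norm_num) t
  have hlognn : Nat.log 2 (n * n) = 2 * t := by
    rw [hndef, ← pow_add, Nat.log_pow (by norm_num)]; ring
  have hMt : M ≤ M * (t + 1) := Nat.le_mul_of_pos_right M (Nat.succ_pos t)
  have hn₀ : n₀ ≤ n := by omega
  -- key inequality: `(c'(t+1) + c(2t+1) + 1) · 2K ≤ n`
  have hkey : (c' * (t + 1) + c * (2 * t + 1) + 1) * (2 * K) ≤ n := by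
    have e1 : M * (t + 1) = 2 * K * (c' * (t + 1)) + 2 * K * (2 * c * (t + 1)) + 2 * K * (t + 1) + n₀ * (t + 1) := by
      rw [hM]; ring
    have e2 : (c' * (t + 1) + c * (2 * t + 1) + 1) * (2 * K) =
        2 * K * (c' * (t + 1)) + 2 * K * (c * (2 * t + 1)) + 2 * K := by ring
    have h3 : 2 * K * (c * (2 * t + 1)) ≤ 2 * K * (2 * c * (t + 1)) :=
      Nat.mul_le_mul_left _ (by nlinarith)
    have h4 : 2 * K ≤ 2 * K * (t + 1) := Nat.le_mul_of_pos_right _ (Nat.succ_pos t)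
    rw [e2]
    rw [e1] at ht
    omega
  have hdiv : c' * (t + 1) + c * (2 * t + 1) + 1 ≤ n / (2 * K) := (Nat.le_div_iff_mul_le (by omega)).mpr hkey
  have hhalf : 2 * (n / (2 * K)) ≤ n / K := by
    rw [mul_comm 2 K, ← Nat.div_div_eq_div_mul]
    exact Nat.mul_div_le (n / K) 2
  -- the hard outer function
  obtain ⟨f, hf⟩ := hhard n hn1
  rw [hlogn] at hf
  have hc'M : c' * (t + 1) ≤ M * (t + 1) := by
    apply Nat.mul_le_mul_right
    calc c' ≤ c' + 2 * c + 1 := by omega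
      _ ≤ 2 * K * (c' + 2 * c + 1) := Nat.le_mul_of_pos_left _ (by omega)
      _ ≤ M := Nat.le_add_right _ _
  have hfnc : ∃ x y, f x ≠ f y := by
    by_contra hall
    have h0 := hf (KWTree.leaf ⟨0, hn1⟩) (solves_of_forall_eq _ fun x y => by
      by_contra hxy; exact hall ⟨x, y, hxy⟩)
    rw [KWTree.depth_leaf] at h0
    omega
  -- the door's inner function
  obtain ⟨g, hg⟩ := hw n n hn1 f hfnc
  refine ⟨n, hn₀, f, g, hfnc, ?_, fun P hP => ?_⟩
  · -- `g` is not constant: otherwise `f ⋄ g` is constant and the leaf protocol contradicts the hardness of `f`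
    by_contra hall
    have hconst : ∀ X Y, blockComp f g X = blockComp f g Y := by
      intro X Y
      simp only [blockComp]
      congr 1
      funext i
      by_contra hxy
      exact hall ⟨_, _, hxy⟩
    obtain ⟨Q, hQ, hQd⟩ := hg (KWTree.leaf (⟨0, hn1⟩, ⟨0, hn1⟩)) (solves_of_forall_eq _ hconst)
    rw [KWTree.depth_leaf, hlognn] at hQd
    have h1 := hf Q hQ
    omega
  · obtain ⟨Q, hQ, hQd⟩ := hg P hP
    rw [hlognn] at hQd
    have h1 := hf Q hQ
    omega

/-- **Hence the route's non-residual cruxes imply Wu's Conjecture 1.2**: a printed open problem (2024) sits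
formally BELOW `StrongComposition ∧ StandardFromStrong` (through the landed `weakKRWFrac_of`). -/
theorem wuConjecture_of_cruxes (h1 : Summit.PneNP.PneNP.Theses.KrwChromaticSteering.StrongComposition)
    (h2 : Summit.PneNP.PneNP.Theses.KrwChromaticSteering.StandardFromStrong) : WuConjecture :=
  wuConjecture_of_weakKRWFrac (weakKRWFrac_of (strongCompositionFrac_of_strongComposition h1) h2)

end Summit.PneNP.PneNP.Cruxes.StrongComposition.VectorGadgetKRW
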